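import Literature.AnabelianGeometry.EtaleTheta.TemperedFrobenioidToyDilationSwap
import Literature.AlgebraicGeometry.Frobenioids.BaseCategoryFSMTypeProofs
import HarnessLib

/-!
# [EtTh] Cor. 3.8 sub-DAG, operations-only rows: the clause "`D_i` of FSMFF-type" of `Cor38Hyp` is LOAD-BEARING for
# row F-2815 `PreservesLinear` — a kernel tightness certificate by the degree↔dilation swap (part 3, proof-only)

S. Mochizuki, *The étale theta function and its Frobenioid-theoretic manifestations*, Publ. RIMS **45** (2009) [EtTh],
Cor. 3.8 pp. 80–81 and its proof p. 81 l. 2–8 ("by [Mzk17], Theorem 3.4, (ii) … (iii) … `Ψ` preserves …")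
[cite: MochizukiEtTh2009, Cor 3.8 p.81]; S. Mochizuki, *The geometry of Frobenioids I*, Kyushu J. Math. **62** (2008)
[FrdI], §0 pp. 14, 17–18 (FSM-, FSMI-morphisms, categories of FSMFF-type), Rem. 3.1.3 p. 58 ("the category `ℕ_{≥1}`
[one object] … is not of FSMFF-type" — the author's own example), Def. 1.1 (i) p. 19 (non-dilating), Thm. 3.4 (iii) p. 62
[cite: MochizukiFrdI2008, Rem. 3.1.3 p.58].  abc-iut cell, block F (fact-proving wave), seat abc-iut-f-142 (gen 3).  PROOF-ONLY
companion (0 definitions) of abc-iut-w5-d124's statements-first sub-DAG `TemperedFrobenioidCor38Sub.lean`; data =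
`TemperedFrobenioidToyDilation.lean` + `TemperedFrobenioidToyDilationSwap.lean` (this seat).

CONTEXT.  The bare universal closures of the operations-only rows F-2809 `Cor38Hyp.PreservesPreSteps`, F-2812
`PreservesOTri`, F-2815 `PreservesLinear` quantify over ALL records `h : Cor38Hyp C₁ C₂` (any equivalence `Ψ` of the
model categories of two typed tempered Frobenioids, `D_i` of FSMFF-type (REAL), `Φ_i` non-dilating (free vocabulary
clause)).  Five seats (abc-iut-f-136/f-137/L1-t13/w6-d040/f-023, 2026-08-26) found no separating model and read the
closures as TRUE ("= [FrdI] Thm. 3.4 (ii)/(iii) model-type over the bare interface"); abc-iut-f-131 named DILATING bases as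
the only room left.  THIS FILE certifies what lives in that room and what closes it:

* `DilSwap.not_preservesMor_isLinear` — for the typed tempered Frobenioid `DilSwap.C` (dilating `Φ = ℚ_{≥0}` over
  `SingleObj ℕ_{≥1}`) the self-equivalence `Ψ = DilSwap.swapEquiv` does NOT preserve linear morphisms (the `Ψ`-half of the
  body of `PreservesLinear` fails: `λ₂ = (1, 2, 0) ↦ (2, 1, 0)`), although both non-dilating CLAUSES of `Cor38Hyp` hold
  (`nonDilating_clause`) — `preservesLinear_shape_false_without_fsmff`;
* `DilSwap.preservesMor_isPreStep_swap`, `map_mem_endSubmonoid_swap` — the same `Ψ` preserves pre-steps and `O^▷(−)`: the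
  mechanism separates F-2815 from F-2809/F-2812;
* the base `SingleObj ℕ_{≥1}` is NOT of FSMFF-type — this is [FrdI] Rem. 3.1.3 itself, in the tree as L1's
  `not_isOfFSMFFType_singleObj_pnat` (`BaseCategoryFSMTypeProofs.lean`: the prime `2` is an FSM non-isomorphism whose FSMI
  factorisation would start with an FSMI endomorphism, excluded by §0 p. 18) — CITED, not restated; hence
  `isEmpty_cor38Hyp_left/right`: NO record `Cor38Hyp` has `DilSwap.C` as a component, and the swap is NOT a counterexample
  to F-2815.
READING (cell vocabulary): F-2815's closure remains undecided-as-typed with desk verdict TRUE; this file proves that any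
proof of it must USE `h.fsmff` (the degree rigidity of [FrdI] Thm. 3.4 (iii) is not a property of the model-Frobenioid
construction alone), i.e. it pins the clause of the typed record that carries the weight print puts on "of FSMFF-type" +
"non-dilating".  No FACT-LIST label changes.  HONEST FRAMING: bookkeeping about OUR typed interfaces; not a statement
about the tempered Frobenioids of a curve, nor about Cor. 3.8 / [FrdI] Thm. 3.4 as printed (whose hypotheses the toy
violates by design); nothing here bears on the disputed [IUTchIII] Cor. 3.12; no side taken; typed ≠ proved.
-/

noncomputable section

namespace Literature.AnabelianGeometry.EtaleTheta

open CategoryTheory Opposite Literature.AlgebraicGeometry.Frobenioids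

namespace DilSwap

/-- Hence `swap λ₂` is NOT linear. [cite: MochizukiFrdI2008, Def. 1.2 (i) p.21] -/
theorem not_isLinear_swap_lam₂ : ¬ C.opsData.IsLinear (swap.map lam₂) := fun h => by
  have h' : (2 : ℕ+) = 1 := h
  exact absurd (congrArg (fun x : ℕ+ => (x : ℕ)) h') (by decide)

/-- **`Ψ = swapEquiv` does NOT preserve linear morphisms** — the `Ψ`-half of the shape of row F-2815
`Cor38Hyp.PreservesLinear` FAILS for this self-equivalence of the category of a typed tempered Frobenioid.
[cite: MochizukiEtTh2009, Cor 3.8 p.81] -/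
theorem not_preservesMor_isLinear :
    ¬ PreFrobenioidData.PreservesMor swapEquiv.functor C.opsData.IsLinear C.opsData.IsLinear := fun h =>
  not_isLinear_swap_lam₂ (h lam₂ isLinear_lam₂)

/-- The swap PRESERVES pre-steps (linear base-isomorphisms `(1, 1, z, ·) ↦ (1, 1, z, ·)`): the mechanism is
invisible to the shape of row F-2809. [cite: MochizukiEtTh2009, Cor 3.8 p.81] -/
theorem preservesMor_isPreStep_swap :
    PreFrobenioidData.PreservesMor swap C.opsData.IsPreStep C.opsData.IsPreStep := by
  rintro X Y φ ⟨hlin, hiso⟩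
  have hd : ModelFrobenioid.degFr φ = 1 := hlin
  have hb : expo (ModelFrobenioid.baseMap φ) = 1 := @expo_eq_one_of_isIso _ _ _ hiso
  refine ⟨?_, ?_⟩
  · change expo (ModelFrobenioid.baseMap φ) = 1
    exact hb
  · change IsIso (arrowAt pt pt (ModelFrobenioid.degFr φ))
    rw [hd]
    exact (inferInstance : IsIso (𝟙 pt))

/-- The swap PRESERVES the submonoids `O^▷(−)` (base-identity linear endomorphisms): the mechanism is invisible to
the shape of row F-2812. [cite: MochizukiEtTh2009, Cor 3.8 p.81] -/
theorem map_mem_endSubmonoid_swap (A : C.category) (α : End A) (hα : α ∈ C.opsData.endSubmonoid A) :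
    (swap.map α : End (swap.obj A)) ∈ C.opsData.endSubmonoid (swap.obj A) := by
  obtain ⟨hbase, hlin⟩ := hα
  have hd : ModelFrobenioid.degFr α = 1 := hlin
  have hb : ModelFrobenioid.baseMap α = 𝟙 _ := hbase
  refine ⟨?_, ?_⟩
  · change arrowAt pt pt (ModelFrobenioid.degFr α) = 𝟙 pt
    rw [hd]
    rfl
  · change expo (ModelFrobenioid.baseMap α) = 1
    rw [hb]
    rfl

/-- "Non-dilating" is carried by `Cor38Hyp` only as the vocabulary clause `V.IsNonDilating`, which the trivial
vocabulary `Toy.monoidVocab` satisfies — although `Φ` IS dilating here. [cite: MochizukiEtTh2009, Cor 3.8 p.80] -/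
theorem nonDilating_clause :
    ∀ (A : (SingleObj ℕ+)ᵒᵖ) (f : A ⟶ A), Toy.monoidVocab.IsNonDilating (C.Φ.carrier A) (C.Φ.pull f) :=
  fun _ _ => trivial

/-- NO record `Cor38Hyp C C'` exists with this `C` on the left: its base `SingleObj ℕ_{≥1}` is not of FSMFF-type ([FrdI]
Rem. 3.1.3, L1's `not_isOfFSMFFType_singleObj_pnat`) … [cite: MochizukiEtTh2009, Cor 3.8 p.80] -/
theorem isEmpty_cor38Hyp_left {D₀' : Type} [Category.{0} D₀'] {T' : RealifiedDivisorMonoids (D₀ := D₀') Toy.monoidVocab}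
    {D' : Type} [Category.{0} D'] {VD' : FrdICatStub.{0, 0, 0} D'} (C' : TemperedFrobenioid T' D' VD') :
    IsEmpty (Cor38Hyp C C') :=
  ⟨fun h => not_isOfFSMFFType_singleObj_pnat h.fsmff.1⟩

/-- … nor on the right. [cite: MochizukiEtTh2009, Cor 3.8 p.80] -/
theorem isEmpty_cor38Hyp_right {D₀' : Type} [Category.{0} D₀'] {T' : RealifiedDivisorMonoids (D₀ := D₀') Toy.monoidVocab}
    {D' : Type} [Category.{0} D'] {VD' : FrdICatStub.{0, 0, 0} D'} (C' : TemperedFrobenioid T' D' VD') :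
    IsEmpty (Cor38Hyp C' C) :=
  ⟨fun h => not_isOfFSMFFType_singleObj_pnat h.fsmff.2⟩

/-- **TIGHTNESS of `Cor38Hyp.fsmff` for row F-2815 (`PreservesLinear`)**: over the typed Def. 3.6 data there is a
tempered Frobenioid `C` (dilating `Φ = ℚ_{≥0}` over the one-object base `SingleObj ℕ_{≥1}`) and a self-equivalence
`Ψ` of its category such that EVERY clause of `Cor38Hyp C C` other than "`D_i` of FSMFF-type" holds (`Ψ`, the two
non-dilating vocabulary clauses) while the body of `PreservesLinear` FAILS. Hence any proof of the universal
closure of F-2815 must use `h.fsmff`. [cite: MochizukiEtTh2009, Cor 3.8 p.81] -/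
theorem preservesLinear_shape_false_without_fsmff :
    ∃ Ψ : C.category ≌ C.category,
      ((∀ (A : (SingleObj ℕ+)ᵒᵖ) (f : A ⟶ A), Toy.monoidVocab.IsNonDilating (C.Φ.carrier A) (C.Φ.pull f)) ∧
          ∀ (A : (SingleObj ℕ+)ᵒᵖ) (f : A ⟶ A), Toy.monoidVocab.IsNonDilating (C.Φ.carrier A) (C.Φ.pull f)) ∧
        ¬ (PreFrobenioidData.PreservesMor Ψ.functor C.opsData.IsLinear C.opsData.IsLinear ∧
            PreFrobenioidData.PreservesMor Ψ.inverse C.opsData.IsLinear C.opsData.IsLinear) :=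
  ⟨swapEquiv, ⟨nonDilating_clause, nonDilating_clause⟩, fun h => not_preservesMor_isLinear h.1⟩
end DilSwap

end Literature.AnabelianGeometry.EtaleTheta

end
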